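import Summits.Ventures.Crystal3D.Theorems.StickyWulffConstantGenericWallFloorStarTransport
import Summits.Ventures.Crystal3D.Theorems.StickyWulffConstantGenericWallFloorTrichotomy
import Summits.Ventures.Crystal3D.Theorems.StickyWulffConstantCoaxialWallLawTerracePropagation
import HarnessLib

/-!
# N-TC, per-exit step: under ONE `ExactOnly` row (C12-55) every exit is unsaturated or an exact twin cap

HONEST FRAMING. Part of the venture `Summits/Ventures/Crystal3D` (cell `crystal3d-full`), helper
`--supports` the crux `GenericWallFloor` (stmt-Ventures-19480) of `route-Ventures-StickyWulffConstant`,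
registered line `WallLedgerG`, open stub `stub_twoSlabAdhesion` (THE CRUX: general fillings).  Planner
cf-p1 ROUTE.md §81(3)/(7): the CHAIN LEDGER `twoSlabAdhesion_chainLedger` (N-TC) replaces the payer
mechanism of 19480-p1's `general_twoSlabAdhesion_modulo_twinCaps` (charge `1/3770`, inputs
`KissingGap`/`KissingClassification`) by the E1 row C12-55 = P₅ = the CLOSED VERTEX STAR, taken BY NAME as
`ExactOnly 0 {w ∈ fccSlots | 0 < ⟪w, s₀⟫}` for one slot `s₀` (wulff-p2's `exactOnly_star_transport` moves
it to every frame/centre/slot).  This file is the per-ball step in the EXIT currency of 19480-p1's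
`…ExitCount` / `…GeneralLedger` (an exit `e` of the grain `A·Λ₀ + t` along the slot `u`: the predecessor
`e − A u ∈ X` has all twelve slots occupied, `e` lacks a slot):

* `exit_owns_closedStar` — the predecessor's full shell hands `e` the closed vertex star of `−u`
  (`e + A w ∈ X` whenever `⟪A w, A u⟫ < 0`; this is TC-2 of §81(3) with «covered» weakened to «full»);
* **`exit_unsaturated_or_twinCap`** — with the C12-55 row: `e` has at most eleven contacts, OR `e` is an
  EXACT TWIN CAP of the grain whose capped (far) triple contains the walk slot `u`
  (`⟪A u, n⟫ = √(2/3)`; the nine near slots occupied, the three far slots EMPTY and their mirror images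
  occupied) — exactly the membership predicate of the `TC` sets of `general_twoSlabAdhesion_modulo_twinCaps`.
  Proof: `exactOnly_star_transport` + `trichotomy_of_exactOnly` (three independent own slots from
  `exists_independent_slots_of_hemisphere`), the interior branch contradicts the missing slot, and in the
  twin branch `⟪A u, n⟫ ∈ {0, −√(2/3)}` is excluded by the full predecessor (`exists_far_frame`: a far slot
  `p` with `⟪u, p⟫ = ±½` would be occupied at `e`, and `u ⊥` all three far slots forces `u = 0`).

WHAT THIS IS NOT: no E1 certificate (C12-55 outside-tube is R39c), no count, not the stub; rung F-C1 not
moved.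
-/

noncomputable section

namespace Summit.Ventures.Crystal3D.Theorems

open Summit.Ventures.Crystal3D Finset
open scoped InnerProductSpace

variable {X : Finset (EuclideanSpace ℝ (Fin 3))}

/-- **An exit owns the closed vertex star of `−u`.**  If the predecessor `e − A u` of `e` is in `X`
with all twelve slots occupied, then `e + A w ∈ X` for every slot `w` with `⟪A w, A u⟫ < 0`
(`w = −u`, giving the predecessor, or `w` one of the four neighbours of `−u`, giving `e − A u + A(u + w)`). -/
theorem exit_owns_closedStar (A : EuclideanSpace ℝ (Fin 3) ≃ₗᵢ[ℝ] EuclideanSpace ℝ (Fin 3))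
    {u : EuclideanSpace ℝ (Fin 3)} (hu : u ∈ fccSlots) {e : EuclideanSpace ℝ (Fin 3)}
    (hd : e - A u ∈ X) (hfull : ∀ w ∈ fccSlots, e - A u + A w ∈ X)
    {w : EuclideanSpace ℝ (Fin 3)} (hw : w ∈ fccSlots) (hlt : ⟪A w, A u⟫_ℝ < 0) : e + A w ∈ X := by
  rcases (mem_closedStar_iff A hu hw).2 hlt with rfl | h
  · rw [map_neg, ← sub_eq_add_neg]; exact hd
  · have h' : ⟪u, w⟫_ℝ = -(1 / 2) := by
      rw [inner_neg_right] at h; rw [real_inner_comm]; linarith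
    have hs : u + w ∈ fccSlots := add_mem_fccSlots_of_inner_eq_neg_half hu hw h'
    have := hfull _ hs
    rwa [map_add, ← add_assoc, sub_add_cancel] at this

/-- The closed vertex star of `−u`, transported to `e` by the frame `A`, lies in the contact shell of the
exit `e`. -/
theorem exit_star_subset_shell (A : EuclideanSpace ℝ (Fin 3) ≃ₗᵢ[ℝ] EuclideanSpace ℝ (Fin 3))
    {u : EuclideanSpace ℝ (Fin 3)} (hu : u ∈ fccSlots) {e : EuclideanSpace ℝ (Fin 3)}
    (hd : e - A u ∈ X) (hfull : ∀ w ∈ fccSlots, e - A u + A w ∈ X) :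
    ((fccSlots.filter fun w => 0 < ⟪w, -u⟫_ℝ).image fun w => e + A w) ⊆
      X.filter fun q => dist e q = 1 := by
  classical
  intro x hx
  obtain ⟨w, hw, rfl⟩ := Finset.mem_image.1 hx
  obtain ⟨hwS, hpos⟩ := Finset.mem_filter.1 hw
  have hlt : ⟪A w, A u⟫_ℝ < 0 := by
    rw [LinearIsometryEquiv.inner_map_map]; rw [inner_neg_right] at hpos; linarith
  refine Finset.mem_filter.2 ⟨exit_owns_closedStar A hu hd hfull hwS hlt, ?_⟩
  rw [dist_eq_norm, show e - (e + A w) = -(A w) by abel, norm_neg, LinearIsometryEquiv.norm_map,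
    norm_eq_one_of_mem_fccSlots hwS]

/-- **N-TC per-exit step.**  `X` `1`-separated; the E1 row C12-55 (closed vertex star of one slot `s₀`,
own pattern around the origin) is exact-only; `e ∈ X` is an EXIT of the grain frame `A` along the slot `u`
(predecessor `e − A u ∈ X` with a full slot shell, and `e` lacks some slot).  Then `e` has at most eleven
contacts, or `e` is an exact twin cap of the grain for a unit `{111}` normal `n` with `⟪A u, n⟫ = √(2/3)`:
the slots with `⟪A w, n⟫ ≤ 0` are occupied, those with `⟪A w, n⟫ > 0` are empty and their mirror images
`e − A w + 2⟪A w, n⟫ n` are occupied. -/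
theorem exit_unsaturated_or_twinCap (hX : ∀ p ∈ X, ∀ q ∈ X, p ≠ q → 1 ≤ dist p q)
    {s₀ : EuclideanSpace ℝ (Fin 3)} (hs₀ : s₀ ∈ fccSlots)
    (hcert : ExactOnly 0 (fccSlots.filter fun w => 0 < ⟪w, s₀⟫_ℝ))
    (A : EuclideanSpace ℝ (Fin 3) ≃ₗᵢ[ℝ] EuclideanSpace ℝ (Fin 3))
    {u : EuclideanSpace ℝ (Fin 3)} (hu : u ∈ fccSlots) {e : EuclideanSpace ℝ (Fin 3)}
    (hd : e - A u ∈ X) (hfull : ∀ w ∈ fccSlots, e - A u + A w ∈ X) (hv : ∃ v ∈ fccSlots, e + A v ∉ X) :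
    (X.filter fun q => dist e q = 1).card ≤ 11 ∨
    ∃ n : EuclideanSpace ℝ (Fin 3), ‖n‖ = 1 ∧
      (∀ w ∈ fccSlots, ⟪A w, n⟫_ℝ = 0 ∨ ⟪A w, n⟫_ℝ = Real.sqrt (2 / 3) ∨ ⟪A w, n⟫_ℝ = -Real.sqrt (2 / 3)) ∧
      ⟪A u, n⟫_ℝ = Real.sqrt (2 / 3) ∧
      (∀ w ∈ fccSlots, ⟪A w, n⟫_ℝ ≤ 0 → e + A w ∈ X) ∧
      (∀ w ∈ fccSlots, 0 < ⟪A w, n⟫_ℝ → e + A w ∉ X ∧ e - A w + (2 * ⟪A w, n⟫_ℝ) • n ∈ X) := by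
  classical
  -- the transported certificate and the own part of the shell
  have hO : ExactOnly e ((fccSlots.filter fun w => 0 < ⟪w, -u⟫_ℝ).image fun w => e + A w) :=
    exactOnly_star_transport hs₀ hcert A e (neg_mem_fccSlots hu)
  have hOsub := exit_star_subset_shell A hu hd hfull
  -- three independent occupied slots (the hemisphere of `−A u`)
  have hν : A u ≠ 0 := by
    intro h
    have := norm_eq_one_of_mem_fccSlots hu
    rw [← A.norm_map, h, norm_zero] at this; exact one_ne_zero this.symm
  obtain ⟨w₁, hw₁, w₂, hw₂, w₃, hw₃, h₁, h₂, h₃, hind⟩ := exists_independent_slots_of_hemisphere A hν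
  rcases trichotomy_of_exactOnly hX A hOsub hO hw₁ hw₂ hw₃ (exit_owns_closedStar A hu hd hfull hw₁ h₁)
      (exit_owns_closedStar A hu hd hfull hw₂ h₂) (exit_owns_closedStar A hu hd hfull hw₃ h₃) hind with
    h11 | hall | ⟨n, hn, hmenu, hle, hgt⟩
  · exact Or.inl h11
  · obtain ⟨v, hv, hvX⟩ := hv
    exact absurd (hall v hv) hvX
  · refine Or.inr ⟨n, hn, hmenu, ?_, hle, hgt⟩
    -- `⟪A u, n⟫ = √(2/3)`: the other two menu values contradict the full predecessor
    have hrpos : 0 < Real.sqrt (2 / 3) := Real.sqrt_pos.2 (by norm_num)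
    rcases hmenu u hu with h0 | hfar | hneg
    · exfalso
      obtain ⟨p₁, hp₁, p₂, hp₂, p₃, hp₃, hn₁, hn₂, hn₃, -, -, -, hind', -⟩ := exists_far_frame A hn hmenu
      -- each far slot `p` is orthogonal to `u`
      have horth : ∀ p ∈ fccSlots, ⟪A p, n⟫_ℝ = Real.sqrt (2 / 3) → ⟪p, u⟫_ℝ = 0 := by
        intro p hp hpn
        have hppos : 0 < ⟪A p, n⟫_ℝ := by rw [hpn]; exact hrpos
        rcases inner_slots_mem hp hu with h | h | h | h | h
        · -- `p = u`: but `⟪A u, n⟫ = 0`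
          have := eq_of_inner_eq_one hp hu h
          rw [← this, h0] at hpn; exact absurd hpn (ne_of_lt hrpos)
        · -- `p − u` is a far slot, hence empty at `e`; but it is `e − A u + A p ∈ X`
          have hs : p - u ∈ fccSlots := sub_mem_fccSlots_of_inner_eq_half hp hu h
          have hspos : 0 < ⟪A (p - u), n⟫_ℝ := by rw [map_sub, inner_sub_left, h0, sub_zero]; exact hppos
          have hmem : e + A (p - u) ∈ X := by
            have := hfull p hp; rwa [map_sub, add_sub, sub_add_eq_add_sub] at *
          exact absurd hmem (hgt _ hs hspos).1
        · exact h
        · -- `u + p` is a slot, so `e + A p = (e − A u) + A(u + p) ∈ X`; but `p` is far, hence empty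
          have hs : u + p ∈ fccSlots :=
            add_mem_fccSlots_of_inner_eq_neg_half hu hp (by rw [real_inner_comm]; exact h)
          have hmem : e + A p ∈ X := by
            have := hfull _ hs; rwa [map_add, ← add_assoc, sub_add_cancel] at this
          exact absurd hmem (hgt p hp hppos).1
        · -- `p = −u`: then `⟪A p, n⟫ = 0`
          have := eq_neg_of_inner_eq_neg_one hp hu h
          have hpn' : ⟪A p, n⟫_ℝ = 0 := by
            rw [this, map_neg, inner_neg_left] at h0; linarith
          rw [hpn'] at hpn; exact absurd hpn (ne_of_lt hrpos)
      have hu0 : u = 0 :=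
        eq_zero_of_inner_eq_zero_of_indep hind' (horth p₁ hp₁ hn₁) (horth p₂ hp₂ hn₂) (horth p₃ hp₃ hn₃)
      have := norm_eq_one_of_mem_fccSlots hu
      rw [hu0, norm_zero] at this; exact one_ne_zero this.symm
    · exact hfar
    · exfalso
      -- `−u` would be a far slot, hence empty; but `e + A(−u) = e − A u ∈ X`
      have hs := neg_mem_fccSlots hu
      have hspos : 0 < ⟪A (-u), n⟫_ℝ := by rw [map_neg, inner_neg_left, hneg, neg_neg]; exact hrpos
      have hmem : e + A (-u) ∈ X := by rw [map_neg, ← sub_eq_add_neg]; exact hd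
      exact (hgt _ hs hspos).1 hmem

end Summit.Ventures.Crystal3D.Theorems

end
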